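import Mathlib.Data.Int.Interval
import Mathlib.Data.Set.Card
import Literature.Barriers.AtomisticToContinuum.ShortRangeStackingBlindness
import HarnessLib

/-!
# The first shells of the hexagonal close packing: proof of `ConwaySloane1999_hcpShells`

This file discharges the named fact `ConwaySloane1999_hcpShells` of
`ShortRangeStackingBlindness.lean`. It is the hcp companion of
`ShortRangeStackingBlindnessProofs.lean`, which proves `ConwaySloane1999_fccShells` by the same
method (there the distance form is the norm form of the lattice `A₃ ≅ D₃`; hcp is not a lattice,
and its distance form carries the parity-dependent letter shift described below).

The source is Conway–Sloane, *Sphere Packings, Lattices and Groups*, Ch. 4 §6.5 eq. (73) and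
Table 4.6: with minimal norm `1` the theta series of the hexagonal close packing begins
`1 + 12q + 6q² + 2q^{8/3} + 18q³ + 12q^{11/3} + 6q⁴ + ⋯`, i.e. `N(1) = 12`, `N(2) = 6`,
`N(8/3) = 2`, `N(3) = 18`, `N(11/3) = 12`, `N(4) = 6` and `N(m) = 0` for the other `m ≤ 4`.
The vendored statement: around every point of `hcpStacking 1 √(2/3)` (the stacking `…ABAB…` of
triangular layers at the ideal spacing, nearest-neighbour distance `1`) there are exactly
`12, 6, 2, 18, 12, 6` points of the stacking at distances `1, √2, √(8/3), √3, √(11/3), 2`, and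
no other distance `≤ 2` occurs. Proved here as `ConwaySloane1999_hcpShells_holds` (axioms
`propext`, `Classical.choice`, `Quot.sound`); no statement is changed and no definition is
introduced.

## Method

Elementary enumeration, as in `BarlowCoordination.lean` (which does the first shell for every
Barlow stacking). For `x = barlowPos 1 √(2/3) alternatingHagg k i j` and the point with offsets
`t = (K, P, Q)`, `y = barlowPos 1 √(2/3) alternatingHagg (k - K) (i - P) (j - Q)`, the tree's
`twelve_mul_dist_barlowPos_sq` reads `12 · dist(x, y)² = 3(2P + Q + Λ)² + (3Q + Λ)² + 8K²` with
the letter shift `Λ = L(k) − L(k − K)`; for the alternating Hägg sequence (`L(m) = 0` for even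
`m`, `1` for odd `m`, `haggLabel_alternating`) `Λ = 0` for even `K` and `Λ = σ`, `σ = -1` resp.
`+1` according as `k` is even resp. odd, for odd `K` (`haggLabel_alternating_sub_sub`,
`twelve_mul_dist_sq_hcp`). A value `≤ 48` of this integer form forces
`(K, P, Q) ∈ [-2, 2] × [-3, 3] × [-2, 2]` (`hcpShellForm_mem_box`), and on that box, for both
signs `σ`, the level sets `12, 24, 32, 36, 44, 48` (`dist² = 1, 2, 8/3, 3, 11/3, 4`) have
`12, 6, 2, 18, 12, 6` elements and `0, 12, 24, 32, 36, 44, 48` are the only values `≤ 48` — a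
finite check by `decide` (`hcpShellForm_decide`). Since `t ↦ y` is injective (uniform
discreteness, `le_dist_barlowPos`), each shell `hcpStacking ∩ sphere x r`, `r ≤ 2`, is in
bijection with the level set `12 r²` (`hcp_inter_sphere_eq_image`, `ncard_hcp_inter_sphere`).

Layer by layer (for the reader; the proof does not use this decomposition): in its own layer
(`K = 0`) a point of the triangular lattice has `6, 6, 6` points at `dist² = 1, 3, 4`; the two
adjacent layers (`|K| = 1`) contribute `3 + 3` points at `dist² = 1`, `3 + 3` at `2` and
`6 + 6` at `3`; the layers `K = ±2`, vertically aligned with layer `k` in hcp, contribute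
`1 + 1` points at `dist² = 8/3` (height `2h = √(8/3)`) and `6 + 6` at `11/3`.

## References

* J. H. Conway, N. J. A. Sloane, *Sphere Packings, Lattices and Groups*, 3rd ed., Grundlehren
  290, Springer 1999: Ch. 4 §6.5 "The hexagonal close-packing", eq. (73) and Table 4.6
  (p. 114); Ch. 1 §1.3 (the layer sequence `…abab…` produces hcp).
-/

noncomputable section

open Literature.MathematicalPhysics.StatisticalMechanics

namespace Literature.Barriers.AtomisticToContinuum

/-! ## The distance form of hcp -/

/-- **Letter shifts of hcp.** For the alternating Hägg sequence (labels `0, 1, 0, 1, …`,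
`haggLabel_alternating`) the letter shift `L(k) − L(k − K)` between layer `k` and layer `k − K`
is `0` for even `K`, and for odd `K` it is `-1` if `k` is even, `+1` if `k` is odd. [folklore] -/
theorem haggLabel_alternating_sub_sub (k K : ℤ) :
    haggLabel alternatingHagg k - haggLabel alternatingHagg (k - K) =
      if K % 2 = 0 then 0 else if k % 2 = 0 then -1 else 1 := by
  rw [haggLabel_alternating, haggLabel_alternating]
  simp only [Int.even_iff]
  split_ifs <;> omega

/-- **The distance form of hcp** (nearest-neighbour distance `1`, layer spacing `√(2/3)`): for
`x = barlowPos 1 √(2/3) alternatingHagg k i j` and the point with offsets `t = (K, P, Q)`,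
`12 · dist² = 3(2P + Q + Λ)² + (3Q + Λ)² + 8K²` with the letter shift `Λ` of
`haggLabel_alternating_sub_sub` (from `twelve_mul_dist_barlowPos_sq`). [folklore] -/
theorem twelve_mul_dist_sq_hcp (k i j : ℤ) (t : ℤ × ℤ × ℤ) :
    12 * dist (barlowPos 1 (√(2 / 3)) alternatingHagg k i j)
        (barlowPos 1 (√(2 / 3)) alternatingHagg (k - t.1) (i - t.2.1) (j - t.2.2)) ^ 2 =
      ((3 * (2 * t.2.1 + t.2.2 + (if t.1 % 2 = 0 then 0 else if k % 2 = 0 then -1 else 1)) ^ 2 +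
          (3 * t.2.2 + (if t.1 % 2 = 0 then 0 else if k % 2 = 0 then -1 else 1)) ^ 2 +
          8 * t.1 ^ 2 : ℤ) : ℝ) := by
  have hh : (√(2 / 3) : ℝ) ^ 2 = 2 / 3 * 1 ^ 2 := by
    rw [Real.sq_sqrt (by norm_num)]; norm_num
  rw [twelve_mul_dist_barlowPos_sq hh alternatingHagg, haggLabel_alternating_sub_sub, one_pow,
    one_mul]
  simp only [sub_sub_cancel]

/-- The offset parametrisation `(K, P, Q) ↦ barlowPos 1 √(2/3) alternatingHagg (k-K) (i-P) (j-Q)`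
of hcp around a point is injective (uniform discreteness `le_dist_barlowPos`). [folklore] -/
theorem hcp_offset_injective (k i j : ℤ) :
    Function.Injective fun t : ℤ × ℤ × ℤ =>
      barlowPos 1 (√(2 / 3)) alternatingHagg (k - t.1) (i - t.2.1) (j - t.2.2) := by
  intro t t' heq
  by_contra hne
  have hne' : (k - t.1, i - t.2.1, j - t.2.2) ≠ (k - t'.1, i - t'.2.1, j - t'.2.2) := by
    intro h0
    simp only [Prod.mk.injEq] at h0
    exact hne (Prod.ext (by omega) (Prod.ext (by omega) (by omega)))
  have hle := le_dist_barlowPos 1 (√(2 / 3)) alternatingHagg zero_le_one (Real.sqrt_nonneg _) hne'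
  have heq' : barlowPos 1 (√(2 / 3)) alternatingHagg (k - t.1) (i - t.2.1) (j - t.2.2) =
      barlowPos 1 (√(2 / 3)) alternatingHagg (k - t'.1) (i - t'.2.1) (j - t'.2.2) := heq
  rw [heq', dist_self] at hle
  have hpos : (0 : ℝ) < min 1 (√(2 / 3)) := lt_min one_pos (Real.sqrt_pos.2 (by norm_num))
  linarith

/-! ## The integer side: bounds and the finite check -/

/-- **A value `≤ 48` of the distance form lies in the box** `|K| ≤ 2`, `|P| ≤ 3`, `|Q| ≤ 2`
(`8K² ≤ 48`, `(3Q + Λ)² ≤ 48`, `3(2P + Q + Λ)² ≤ 48` with `|Λ| ≤ 1`). [folklore] -/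
theorem hcpShellForm_mem_box {σ : ℤ} (hσ : σ = 1 ∨ σ = -1) {t : ℤ × ℤ × ℤ}
    (ht : 3 * (2 * t.2.1 + t.2.2 + (if t.1 % 2 = 0 then 0 else σ)) ^ 2 +
        (3 * t.2.2 + (if t.1 % 2 = 0 then 0 else σ)) ^ 2 + 8 * t.1 ^ 2 ≤ 48) :
    t ∈ Finset.Icc (-2 : ℤ) 2 ×ˢ Finset.Icc (-3 : ℤ) 3 ×ˢ Finset.Icc (-2 : ℤ) 2 := by
  obtain ⟨K, P, Q⟩ := t
  dsimp only at ht
  have hΛ : -1 ≤ (if K % 2 = 0 then (0 : ℤ) else σ) ∧ (if K % 2 = 0 then (0 : ℤ) else σ) ≤ 1 := by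
    split_ifs <;> omega
  generalize (if K % 2 = 0 then (0 : ℤ) else σ) = Λ at ht hΛ
  have h1 : K ^ 2 ≤ 6 := by nlinarith [sq_nonneg (2 * P + Q + Λ), sq_nonneg (3 * Q + Λ)]
  have h2 : (3 * Q + Λ) ^ 2 ≤ 48 := by nlinarith [sq_nonneg (2 * P + Q + Λ), sq_nonneg K]
  have h3 : (2 * P + Q + Λ) ^ 2 ≤ 16 := by nlinarith [sq_nonneg (3 * Q + Λ), sq_nonneg K]
  have hK : -2 ≤ K ∧ K ≤ 2 := by constructor <;> nlinarith
  have hQ : -6 ≤ 3 * Q + Λ ∧ 3 * Q + Λ ≤ 6 := by constructor <;> nlinarith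
  have hP : -4 ≤ 2 * P + Q + Λ ∧ 2 * P + Q + Λ ≤ 4 := by constructor <;> nlinarith
  simp only [Finset.mem_product, Finset.mem_Icc]
  omega

/-- **The finite check** (by `decide`), for both signs `σ = ±1` of the odd-layer letter shift:
on the box `[-2, 2] × [-3, 3] × [-2, 2]` the level sets `12, 24, 32, 36, 44, 48` of the distance
form `3(2P + Q + Λ)² + (3Q + Λ)² + 8K²` (`Λ = 0` for even `K`, `σ` for odd `K`) have
`12, 6, 2, 18, 12, 6` elements — the entries `N(1), N(2), N(8/3), N(3), N(11/3), N(4)` of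
Conway–Sloane's Table 4.6 — and `0, 12, 24, 32, 36, 44, 48` are its only values `≤ 48` there
(the zeros of Table 4.6 below `m = 4`). [folklore] -/
theorem hcpShellForm_decide :
    ∀ σ ∈ ({1, -1} : Finset ℤ),
      (∀ Nc ∈ ({((12 : ℤ), (12 : ℕ)), (24, 6), (32, 2), (36, 18), (44, 12), (48, 6)} :
          Finset (ℤ × ℕ)),
        ((Finset.Icc (-2 : ℤ) 2 ×ˢ Finset.Icc (-3 : ℤ) 3 ×ˢ Finset.Icc (-2 : ℤ) 2).filter
            (fun t : ℤ × ℤ × ℤ =>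
              3 * (2 * t.2.1 + t.2.2 + (if t.1 % 2 = 0 then 0 else σ)) ^ 2 +
                (3 * t.2.2 + (if t.1 % 2 = 0 then 0 else σ)) ^ 2 + 8 * t.1 ^ 2 = Nc.1)).card =
          Nc.2) ∧
      ∀ t ∈ Finset.Icc (-2 : ℤ) 2 ×ˢ Finset.Icc (-3 : ℤ) 3 ×ˢ Finset.Icc (-2 : ℤ) 2,
        3 * (2 * t.2.1 + t.2.2 + (if t.1 % 2 = 0 then 0 else σ)) ^ 2 +
            (3 * t.2.2 + (if t.1 % 2 = 0 then 0 else σ)) ^ 2 + 8 * t.1 ^ 2 ≤ 48 →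
          3 * (2 * t.2.1 + t.2.2 + (if t.1 % 2 = 0 then 0 else σ)) ^ 2 +
              (3 * t.2.2 + (if t.1 % 2 = 0 then 0 else σ)) ^ 2 + 8 * t.1 ^ 2 ∈
            ({0, 12, 24, 32, 36, 44, 48} : Finset ℤ) := by
  decide +kernel

/-! ## Shells of hcp as images of level sets -/

/-- **The shell of radius `r` about a point of hcp is the offset image of the level set `12 r²`
of the distance form** (`0 ≤ r`, `12 r² = N`). [folklore] -/
theorem hcp_inter_sphere_eq_image (k i j : ℤ) {r : ℝ} (hr : 0 ≤ r) {N : ℤ}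
    (hN : 12 * r ^ 2 = (N : ℝ)) :
    hcpStacking 1 (√(2 / 3)) ∩ Metric.sphere (barlowPos 1 (√(2 / 3)) alternatingHagg k i j) r =
      (fun t : ℤ × ℤ × ℤ =>
          barlowPos 1 (√(2 / 3)) alternatingHagg (k - t.1) (i - t.2.1) (j - t.2.2)) ''
        {t |
          3 * (2 * t.2.1 + t.2.2 + (if t.1 % 2 = 0 then 0 else if k % 2 = 0 then -1 else 1)) ^ 2 +
              (3 * t.2.2 + (if t.1 % 2 = 0 then 0 else if k % 2 = 0 then -1 else 1)) ^ 2 +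
            8 * t.1 ^ 2 = N} := by
  ext y
  simp only [Set.mem_inter_iff, Metric.mem_sphere, Set.mem_image, Set.mem_setOf_eq]
  constructor
  · rintro ⟨⟨k', i', j', rfl⟩, hy⟩
    refine ⟨(k - k', i - i', j - j'), ?_, ?_⟩
    · have h12 := twelve_mul_dist_sq_hcp k i j (k - k', i - i', j - j')
      dsimp only at h12 ⊢
      simp only [sub_sub_cancel] at h12
      rw [dist_comm] at hy
      rw [hy, hN] at h12
      exact_mod_cast h12.symm
    · simp only [sub_sub_cancel]
  · rintro ⟨t, ht, rfl⟩
    refine ⟨barlowPos_mem _ _ _, ?_⟩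
    have h12 := twelve_mul_dist_sq_hcp k i j t
    rw [ht] at h12
    rw [dist_comm]
    have h2 : dist (barlowPos 1 (√(2 / 3)) alternatingHagg k i j)
        (barlowPos 1 (√(2 / 3)) alternatingHagg (k - t.1) (i - t.2.1) (j - t.2.2)) ^ 2 = r ^ 2 := by
      linarith
    exact (sq_eq_sq₀ dist_nonneg hr).1 h2

/-- **Shell cardinalities of hcp are level-set cardinalities of the distance form**: for
`0 ≤ r`, `12 r² = N ≤ 48`, the number of points of `hcpStacking 1 √(2/3)` at distance `r` from
`barlowPos 1 √(2/3) alternatingHagg k i j` is the number of box points on the level set `N`.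
[folklore] -/
theorem ncard_hcp_inter_sphere (k i j : ℤ) {r : ℝ} (hr : 0 ≤ r) {N : ℤ}
    (hN : 12 * r ^ 2 = (N : ℝ)) (hN48 : N ≤ 48) :
    (hcpStacking 1 (√(2 / 3)) ∩
        Metric.sphere (barlowPos 1 (√(2 / 3)) alternatingHagg k i j) r).ncard =
      ((Finset.Icc (-2 : ℤ) 2 ×ˢ Finset.Icc (-3 : ℤ) 3 ×ˢ Finset.Icc (-2 : ℤ) 2).filter
          (fun t : ℤ × ℤ × ℤ =>
            3 * (2 * t.2.1 + t.2.2 + (if t.1 % 2 = 0 then 0 else if k % 2 = 0 then -1 else 1)) ^ 2 +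
                (3 * t.2.2 + (if t.1 % 2 = 0 then 0 else if k % 2 = 0 then -1 else 1)) ^ 2 +
              8 * t.1 ^ 2 = N)).card := by
  rw [hcp_inter_sphere_eq_image k i j hr hN,
    Set.ncard_image_of_injective _ (hcp_offset_injective k i j), ← Set.ncard_coe_finset]
  have hσ : (if k % 2 = 0 then (-1 : ℤ) else 1) = 1 ∨ (if k % 2 = 0 then (-1 : ℤ) else 1) = -1 := by
    split_ifs <;> simp
  congr 1
  ext t
  simp only [Set.mem_setOf_eq, Finset.coe_filter]
  exact ⟨fun h => ⟨hcpShellForm_mem_box hσ (h.trans_le hN48), h⟩, And.right⟩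

/-- **The distances `≤ 2` that occur in hcp.** If `12 d² ` is a value of the distance form and
`0 ≤ d ≤ 2`, then `d ∈ {0, 1, √2, √(8/3), √3, √(11/3), 2}`. [folklore] -/
theorem hcpShellForm_values {σ : ℤ} (hσ : σ = 1 ∨ σ = -1) {K P Q : ℤ} {d : ℝ} (hd0 : 0 ≤ d)
    (hd : d ≤ 2)
    (h12 : 12 * d ^ 2 = ((3 * (2 * P + Q + (if K % 2 = 0 then 0 else σ)) ^ 2 +
      (3 * Q + (if K % 2 = 0 then 0 else σ)) ^ 2 + 8 * K ^ 2 : ℤ) : ℝ)) :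
    d ∈ ({0, 1, √2, √(8 / 3), √3, √(11 / 3), 2} : Set ℝ) := by
  have hσ' : σ ∈ ({1, -1} : Finset ℤ) := by rcases hσ with rfl | rfl <;> decide
  generalize hF : (3 * (2 * P + Q + (if K % 2 = 0 then 0 else σ)) ^ 2 +
      (3 * Q + (if K % 2 = 0 then 0 else σ)) ^ 2 + 8 * K ^ 2 : ℤ) = F at h12
  have hF48 : F ≤ 48 := by
    have : (F : ℝ) ≤ 48 := by rw [← h12]; nlinarith
    exact_mod_cast this
  have hmem : (K, P, Q) ∈ Finset.Icc (-2 : ℤ) 2 ×ˢ Finset.Icc (-3 : ℤ) 3 ×ˢ Finset.Icc (-2 : ℤ) 2 :=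
    hcpShellForm_mem_box hσ (by dsimp only; rw [hF]; exact hF48)
  have hv := (hcpShellForm_decide σ hσ').2 (K, P, Q) hmem (by dsimp only; rw [hF]; exact hF48)
  dsimp only at hv
  rw [hF] at hv
  simp only [Finset.mem_insert, Finset.mem_singleton] at hv
  have hd' : d = √((F : ℝ) / 12) := by
    rw [← h12, mul_div_cancel_left₀ _ (by norm_num : (12 : ℝ) ≠ 0), Real.sqrt_sq hd0]
  rw [hd']
  rcases hv with rfl | rfl | rfl | rfl | rfl | rfl | rfl
  · rw [show ((0 : ℤ) : ℝ) / 12 = 0 by norm_num, Real.sqrt_zero]; simp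
  · rw [show ((12 : ℤ) : ℝ) / 12 = 1 by norm_num, Real.sqrt_one]; simp
  · rw [show ((24 : ℤ) : ℝ) / 12 = 2 by norm_num]; simp
  · rw [show ((32 : ℤ) : ℝ) / 12 = 8 / 3 by norm_num]; simp
  · rw [show ((36 : ℤ) : ℝ) / 12 = 3 by norm_num]; simp
  · rw [show ((44 : ℤ) : ℝ) / 12 = 11 / 3 by norm_num]; simp
  · rw [show ((48 : ℤ) : ℝ) / 12 = 2 ^ 2 by norm_num, Real.sqrt_sq zero_le_two]; simp

/-! ## The theorem -/

/-- **Proof of `ConwaySloane1999_hcpShells`** (Conway–Sloane, Ch. 4 §6.5 (73), Table 4.6): around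
every point of `hcpStacking 1 √(2/3)` there are exactly `12, 6, 2, 18, 12, 6` points of the
stacking at distances `1, √2, √(8/3), √3, √(11/3), 2`, and every distance `≤ 2` between points of
the stacking is one of `0, 1, √2, √(8/3), √3, √(11/3), 2`.
[cite: ConwaySloane1999, Ch. 4 §6.5 (73) and Table 4.6] -/
theorem ConwaySloane1999_hcpShells_holds : ConwaySloane1999_hcpShells := by
  rintro x ⟨k, i, j, rfl⟩
  have hσ : (if k % 2 = 0 then (-1 : ℤ) else 1) ∈ ({1, -1} : Finset ℤ) := by
    split_ifs <;> decide
  have hσ' :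
      (if k % 2 = 0 then (-1 : ℤ) else 1) = 1 ∨ (if k % 2 = 0 then (-1 : ℤ) else 1) = -1 := by
    split_ifs <;> simp
  obtain ⟨hcard, -⟩ := hcpShellForm_decide _ hσ
  have h2 : (12 : ℝ) * √2 ^ 2 = ((24 : ℤ) : ℝ) := by rw [Real.sq_sqrt (by norm_num)]; norm_num
  have h83 : (12 : ℝ) * √(8 / 3) ^ 2 = ((32 : ℤ) : ℝ) := by
    rw [Real.sq_sqrt (by norm_num)]; norm_num
  have h3 : (12 : ℝ) * √3 ^ 2 = ((36 : ℤ) : ℝ) := by rw [Real.sq_sqrt (by norm_num)]; norm_num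
  have h113 : (12 : ℝ) * √(11 / 3) ^ 2 = ((44 : ℤ) : ℝ) := by
    rw [Real.sq_sqrt (by norm_num)]; norm_num
  refine ⟨?_, ?_, ?_, ?_, ?_, ?_, ?_⟩
  · rw [ncard_hcp_inter_sphere k i j zero_le_one (N := 12) (by norm_num) (by norm_num)]
    exact hcard (12, 12) (by decide)
  · rw [ncard_hcp_inter_sphere k i j (Real.sqrt_nonneg _) h2 (by norm_num)]
    exact hcard (24, 6) (by decide)
  · rw [ncard_hcp_inter_sphere k i j (Real.sqrt_nonneg _) h83 (by norm_num)]
    exact hcard (32, 2) (by decide)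
  · rw [ncard_hcp_inter_sphere k i j (Real.sqrt_nonneg _) h3 (by norm_num)]
    exact hcard (36, 18) (by decide)
  · rw [ncard_hcp_inter_sphere k i j (Real.sqrt_nonneg _) h113 (by norm_num)]
    exact hcard (44, 12) (by decide)
  · rw [ncard_hcp_inter_sphere k i j zero_le_two (N := 48) (by norm_num) le_rfl]
    exact hcard (48, 6) (by decide)
  · rintro y ⟨k', i', j', rfl⟩ hd
    have h12 := twelve_mul_dist_sq_hcp k i j (k - k', i - i', j - j')
    dsimp only at h12
    simp only [sub_sub_cancel] at h12
    exact hcpShellForm_values hσ' dist_nonneg hd h12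

end Literature.Barriers.AtomisticToContinuum

end
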